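import Literature.AlgebraicGeometry.AbelianVarieties.AbelianVarietyWeilDivisorBundleDictionary
import Literature.AlgebraicGeometry.AbelianVarieties.PicZeroOntoOfFiniteKTheta
import Literature.AlgebraicGeometry.Modules.DetClassOfIso
import HarnessLib

/-!
# Every homogeneous line bundle on an abelian variety over `Ω = Ω̄` of ANY characteristic is a Mumford bundle `t_a^*𝒪(Θ) ⊗ 𝒪(Θ)⁻¹`
# ([MumfordAV1970] §8 Theorem 1 in MODULE currency, any characteristic)

Layer `Literature/AlgebraicGeometry/AbelianVarieties`, namespace `Literature.AlgebraicGeometry.AbelianVarieties`.  THEOREMS ONLY (no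
definition, no named fact, no instance, no notation, no `sorry`).  Cell `hodgecm-mathlib` (D-0151), DUAL-S road (A), the ANY-CHARACTERISTIC twin of ★
`PicZeroSlicesAnyField` (which carries `[CharZero Ω]` because its divisor-currency input ★
`AbelianVariety.exists_linEquiv_weilDiv_of_forall_translate_linEquiv_of_isAlgClosed` is obtained by transport from `ℂ`): the three letters are
repeated TOKEN FOR TOKEN with the instance `[CharZero Ω]` removed, the divisor-currency input being now ★ (CBC-4)
`exists_linEquiv_weilDiv_of_forall_translate_linEquiv_of_finite` ∕ `…_of_isAmple` (`AbelianVarieties/PicZeroOntoOfFiniteKTheta`, [MumfordAV1970] §8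
Theorem 1 proved in the tree by Mumford's own cohomology-and-base-change argument, any characteristic).  For `X` an abelian variety over an
algebraically closed field `Ω`, `Θ` a Cartier divisor with `K(Θ)(Ω) = {x ∈ X(Ω) ; t_x^*Θ ∼ Θ}` FINITE (the hypothesis `hK`; for `Θ` ample it is
`X.finite_KTheta hΘ`, [MumfordAV1970] §6 Application 1 = ★ `AbelianVariety.finite_KTheta` — the printed form is the one-token instantiation
`… Θ (X.finite_KTheta hΘ) …`, not restated here) and `E` a rank-one module with `IsHomogeneous X E` (`t_x^*E ≅ E` for all `x ∈ X(Ω)`,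
[MumfordAV1970] §8 (iv)):

* **`exists_detClass_eq_cechClass_weilDiv_of_isHomogeneous_of_finite`** — `[E] = [𝒪(t_a^*Θ − Θ)]` in `Ȟ¹(X, 𝒪^×)` for some `a ∈ X(Ω)`;
* **`exists_nonempty_iso_translateTensorDual_of_isHomogeneous_of_finite`** — `E ≅ t_a^*𝒪(Θ) ⊗ 𝒪(Θ)⁻¹`;
* **`exists_nonempty_iso_lineBundle_weilDiv_of_isHomogeneous_of_finite`** — `E ≅ 𝒪(t_a^*Θ − Θ)`.

HC_CM is proved only modulo the 7 printed citations until rung 0 closes; nothing here bears on a summit statement (count-neutral ★ capital: it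
removes `[CharZero]` from the module-currency `Pic⁰`-surjectivity consumed by the (Mc) N3′ level-0 port ★ `AbelianSchemes/GraphPointLevelZero`).

## References
* [MumfordAV1970] D. Mumford, *Abelian Varieties* (1970), §8 Theorem 1 (p. 77) and its proof (pp. 77–78), §8 (i)–(iv) (pp. 74–75), §6 Application 1 (p. 60).
* [MumfordFogartyKirwan1994] D. Mumford, J. Fogarty, F. Kirwan, *Geometric Invariant Theory*, 3rd ed. (1994), Ch. 6 §2 Def. 6.2 (p. 120).
* [GortzWedhorn2020] U. Görtz, T. Wedhorn, *Algebraic Geometry I*, 2nd ed. (2020), Prop. 11.21 (p. 374).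
-/

set_option autoImplicit false

noncomputable section

open CategoryTheory CategoryTheory.Limits AlgebraicGeometry MonoidalCategory

namespace Literature.AlgebraicGeometry.AbelianVarieties

open Literature.AlgebraicGeometry.Motives Literature.AlgebraicGeometry.Modules
open scoped MonObj

variable {Ω : Type} [Field Ω] [IsAlgClosed Ω] (X : AbelianVariety Ω)

/-- **[E] = [𝒪(t_a^*Θ − Θ)] for every rank-one homogeneous `E`, ANY characteristic** (`Ω` algebraically closed, `K(Θ)(Ω) = {x ; t_x^*Θ ∼ Θ}`
finite): `E ≅ 𝒪(D₀)` with `D₀` translation-invariant (★ `isHomogeneous_iff_exists_iso_lineBundle`), and `D₀ ∼ t_a^*Θ − Θ` by [MumfordAV1970]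
§8 Theorem 1 in any characteristic (★ `exists_linEquiv_weilDiv_of_forall_translate_linEquiv_of_finite`).
[cite: MumfordAV1970, §8 Theorem 1 (p. 77) and its proof (pp. 77–78)] -/
theorem exists_detClass_eq_cechClass_weilDiv_of_isHomogeneous_of_finite (Θ : CartierDivisor X.X.left)
    (hK : {x : X.Points Ω | (X.weilDiv Θ x).LinEquiv 0}.Finite) {E : X.X.left.Modules} (hE1 : HasRank E 1)
    (hhom : IsHomogeneous X E) :
    ∃ a : X.Points Ω, detClass (HasRank.isFiniteLocallyFree' hE1) = (X.weilDiv Θ a).cechClass := by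
  -- `E ≅ 𝒪(D₀)` with `t_x^* D₀ ∼ D₀` for every `x`
  obtain ⟨D₀, -, ⟨φ⟩⟩ := (isHomogeneous_iff_exists_iso_lineBundle X hE1).1 hhom
  have hD₀ : ∀ x : X.Points Ω, (D₀.pullback (X.translation x).left).LinEquiv D₀ :=
    (isHomogeneous_iff_forall_linEquiv_of_iso X φ).1 hhom
  -- Mumford §8 Theorem 1 over `Ω`, any characteristic: `D₀ ∼ t_a^*Θ − Θ`
  obtain ⟨a, ha⟩ := exists_linEquiv_weilDiv_of_forall_translate_linEquiv_of_finite X Θ hK D₀ hD₀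
  refine ⟨a, ?_⟩
  rw [detClass_eq_cechClass_of_iso φ (HasRank.isFiniteLocallyFree' hE1)]
  exact ha.cechClass_eq

/-- **Every rank-one homogeneous `E` is a Mumford bundle, ANY characteristic: `E ≅ t_a^*𝒪(Θ) ⊗ 𝒪(Θ)⁻¹`** for some `a ∈ X(Ω)` (`Ω = Ω̄`,
`K(Θ)(Ω)` finite) — the module form of [MumfordAV1970] §8 Theorem 1 «`Pic⁰(X) = φ_Θ(X(Ω))`»; classes by ★
`detClass_translateTensorDual_eq_cechClass_weilDiv` and ★ `nonempty_iso_iff_detClass_eq`.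
[cite: MumfordAV1970, §8 Theorem 1 (p. 77) and its proof (pp. 77–78)] [cite: MumfordFogartyKirwan1994, Ch. 6 §2 Definition 6.2 (p. 120)] -/
theorem exists_nonempty_iso_translateTensorDual_of_isHomogeneous_of_finite (Θ : CartierDivisor X.X.left)
    (hK : {x : X.Points Ω | (X.weilDiv Θ x).LinEquiv 0}.Finite) {E : X.X.left.Modules} (hE1 : HasRank E 1)
    (hhom : IsHomogeneous X E) :
    ∃ a : X.Points Ω, Nonempty (E ≅
      tensorObj ((Scheme.Modules.pullback (X.translation a).left).obj (lineBundle Θ.toUnitCocycle))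
        (Modules.dual (lineBundle Θ.toUnitCocycle))) := by
  obtain ⟨a, ha⟩ := exists_detClass_eq_cechClass_weilDiv_of_isHomogeneous_of_finite X Θ hK hE1 hhom
  refine ⟨a, ?_⟩
  have hM1 : HasRank (tensorObj ((Scheme.Modules.pullback (X.translation a).left).obj (lineBundle Θ.toUnitCocycle))
      (Modules.dual (lineBundle Θ.toUnitCocycle))) 1 :=
    hasRank_tensorObj_one (hasRank_pullback _ Θ.toUnitCocycle.hasRank_lineBundle)
      (hasRank_dual Θ.toUnitCocycle.hasRank_lineBundle)
  refine (nonempty_iso_iff_detClass_eq hE1 hM1 (HasRank.isFiniteLocallyFree' hE1) (HasRank.isFiniteLocallyFree' hM1)).2 ?_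
  rw [ha, detClass_translateTensorDual_eq_cechClass_weilDiv X Θ a]

/-- **`E ≅ 𝒪(t_a^*Θ − Θ)`** for some `a ∈ X(Ω)`, for every rank-one homogeneous `E`, ANY characteristic (`Ω = Ω̄`, `K(Θ)(Ω)` finite).
[cite: MumfordAV1970, §8 Theorem 1 (p. 77) and its proof (pp. 77–78)] -/
theorem exists_nonempty_iso_lineBundle_weilDiv_of_isHomogeneous_of_finite (Θ : CartierDivisor X.X.left)
    (hK : {x : X.Points Ω | (X.weilDiv Θ x).LinEquiv 0}.Finite) {E : X.X.left.Modules} (hE1 : HasRank E 1)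
    (hhom : IsHomogeneous X E) :
    ∃ a : X.Points Ω, Nonempty (E ≅ lineBundle (X.weilDiv Θ a).toUnitCocycle) := by
  obtain ⟨a, ha⟩ := exists_detClass_eq_cechClass_weilDiv_of_isHomogeneous_of_finite X Θ hK hE1 hhom
  refine ⟨a, (nonempty_iso_iff_detClass_eq hE1 (X.weilDiv Θ a).toUnitCocycle.hasRank_lineBundle
    (HasRank.isFiniteLocallyFree' hE1) (X.weilDiv Θ a).toUnitCocycle.isFiniteLocallyFree_lineBundle).2 ?_⟩
  rw [ha, (X.weilDiv Θ a).toUnitCocycle.detClass_lineBundle]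
  rfl

end Literature.AlgebraicGeometry.AbelianVarieties

end
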